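import Mathlib
import Literature.MathematicalPhysics.QuantumFieldTheory.Balaban1983to89.B7Prop2Explicit
import Summits.QuantumFields.Balaban3D.Proofs.CouplingWindow

/-!
# `Summit.QuantumFields.Balaban3D.Proofs.Thresholds` — lane «pub-balaban3d» (Bałaban, CMP **102** (1985) 255–275, d = 3
# lattice UV stability AS PRINTED), prover seat p2: the coupling thresholds `γ₄₆`, `γ₇₁` of rows B15 (46) and B25 (71)
# as CLOSED CONSTANTS with their export lemmas (lead ruling R-EPS0′, 2026-08-22T00:04Z)

HONEST FRAMING (lane PLAN.md §0).  Nothing of [B10] = [Balaban1985UV3] is asserted.  p. 256 L15–18: *«We terminate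
constructions of the densities ρ_k when we reach the unit lattice, or more exactly when L^kε = ε₀, where ε₀ is a positive
constant depending on the coupling constant g only.»* — the lane reads every «for g_{k−1} sufficiently small» ((45) p. 267 L9)
and «for g_j sufficiently small» ((71) p. 273 L27) as `g_k ≤ γ₀` with ONE explicit `γ₀ < 1`, and the end theorem exhibits
`ε₀(g) = (min γ₀ 1)²/g²`; `γ₀` is the minimum of the seats' named thresholds (R-EPS0′, R-CONST).  THIS FILE names p2's two:
* `sigmaReg L N B₃` — the common bound on `s = g·p(g)` making `α₀ = 2L²B₃s` admissible for [4] Prop. 2 (`C₀α₀ ≤ ⅓`,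
  `2α₀ ≤ c₂′`: `B7Prop2Explicit.C0/c2'`) and keeping the average in `SU(N)` (`N·32(d+1)(d+4)L²α₀ < π`,
  `B7Prop2SpecialUnitary.avgClosedAt_specialUnitary`);
* `sigma46 L N B₃ M₁ κ₁ = min sigmaReg (1/(16L²B₃Z₃))`, `Z3 M₁ κ₁ = 3(2M₁/κ₁)(1 + 4M₁/κ₁)³` — (45)'s «8L²B₃Z₃·g p(g) ≤ ½»
  (`B10Eq45LatticeSum.bound45_latticeGeometry3`);
* `sigma71 L N B₃ = min sigmaReg (min 1 (1/(4K₇₁)))` — (71)'s «½(2C₁C₂ + C₂²)·g p(g) ≤ ¼», `C₁ = 2L²B₃`, `C₂ = (16/3)C₀C₁²`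
  (`B10Eq71Concrete.smallFactor_specialUnitary`);
* `gammaOf b₀ p₀ σ = min 1 (σ/(b₀Q₀))²`, `Q0 p₀ = (2p₀)^{p₀}e^{½−p₀}` — the coupling threshold for «g·p(g) ≤ σ»
  (`CouplingWindow.gp_le_of_le_gamma`); `tau46` — the radius threshold of `CouplingWindow.hD_of_threshold`;
  `gamma46 = min (gammaOf b₀ p₀ sigma46) tau46²`, `gamma71 = gammaOf b₀ p₀ sigma71`;
* §3 (the LOCAL form, `B10Eq69Local`: (68) only on `Δ′ ⊂ B^j(Λ_j)` as printed, `O(1) = C₁` explicit): `K71L C₁`, `sigma68 C₁ L`,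
  `gamma71L C₁ L b₀ p₀` with `sigma68_spec`, `gamma71L_spec`;
with the EXPORT LEMMAS `sigmaReg_spec`, `sigma46_spec`, `sigma71_spec` (the inequalities `hσ₁`–`hσ₅` of the seat's leaf
theorems), `gammaOf_spec` (`0 < g ≤ gammaOf ⇒ g·p(g) ≤ σ`), `gamma46_spec`, `gamma71_spec`, positivity.  Pure real arithmetic on
explicit constants; definitions with bodies, no `Prop`-valued defs.
-/

noncomputable section

namespace Summit.QuantumFields.Balaban3D.Proofs.Thresholds

open Literature.MathematicalPhysics.QuantumFieldTheory.Balaban1983to89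
open B7Prop2Explicit (C0 c2' C0_pos c2'_pos)
open Summit.QuantumFields.Balaban3D.Proofs.CouplingWindow (gp_le_of_le_gamma gp_le_sqrt)

/-! ## §1 The `σ`-thresholds on `s = g·p(g)` -/

section Sigma

/-- `Z₃ = 3(2M₁/κ₁)(1 + 4M₁/κ₁)³`, the bound of the one-block lattice sum of (45) on `ℤ³`
(`B10Eq45LatticeSum.latticeSum45_geometry3`). [cite: Balaban1985UV3, (45) p.267] -/
def Z3 (M₁ κ₁ : ℝ) : ℝ := 3 * ((2 * M₁ / κ₁) * (1 + 4 * M₁ / κ₁) ^ 3)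

/-- `Z₃ > 0` for `M₁, κ₁ > 0`. [folklore] -/
theorem Z3_pos {M₁ κ₁ : ℝ} (hM : 0 < M₁) (hκ : 0 < κ₁) : 0 < Z3 M₁ κ₁ := by
  unfold Z3; positivity

/-- The common REGULARITY threshold on `s = g·p(g)`: the largest `σ` such that `α₀ = 2L²B₃σ` satisfies [4] Prop. 2's smallness
`C₀α₀ ≤ ⅓`, `2α₀ ≤ c₂′(3, L)` and (with a factor ½ of room) the `SU(N)` closure radius `N·32·4·7·L²α₀ < π`. [cite: Balaban1985UV3, (44) p.267, (68) p.273] -/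
def sigmaReg (L N : ℕ) (B₃ : ℝ) : ℝ :=
  min (1 / (3 * C0 3 * (2 * (L : ℝ) ^ 2 * B₃)))
    (min (c2' 3 L / (2 * (2 * (L : ℝ) ^ 2 * B₃)))
      (Real.pi / (2 * ((N : ℝ) * (32 * ((3 : ℝ) + 1) * (3 + 4) * (L : ℝ) ^ 2 * (2 * (L : ℝ) ^ 2 * B₃))))))

/-- `sigmaReg > 0` (`L, N ≥ 1`, `B₃ > 0`). [folklore] -/
theorem sigmaReg_pos {L N : ℕ} {B₃ : ℝ} (hL : 1 ≤ L) (hN : 1 ≤ N) (hB : 0 < B₃) : 0 < sigmaReg L N B₃ := by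
  have hLr : (1 : ℝ) ≤ L := by exact_mod_cast hL
  have hNr : (1 : ℝ) ≤ N := by exact_mod_cast hN
  have hC0 := C0_pos 3
  have hc2 := c2'_pos 3 L hL
  unfold sigmaReg
  refine lt_min (by positivity) (lt_min (by positivity) (by positivity))

/-- EXPORT: for `σ ≤ sigmaReg`, the three premises `hσ₁`, `hσ₂`, `hσ₃` of the leaf form `bound46_leaf` (HOME drafts/p2/Bound46Knit.lean :104, a documentation draft, not in the tree; giving `hα3`/`hα2`/`hαN` of LQB `B10Eq44SpecialUnitary.bound46_specialUnitary` once `g·pg ≤ σ`) /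
`PerPlaquette71.perPlaquette71_run`. [cite: Balaban1985UV3, (44) p.267, (68) p.273] -/
theorem sigmaReg_spec {L N : ℕ} {B₃ σ : ℝ} (hL : 1 ≤ L) (hN : 1 ≤ N) (hB : 0 < B₃)
    (hσ : σ ≤ sigmaReg L N B₃) :
    C0 3 * (2 * (L : ℝ) ^ 2 * B₃ * σ) ≤ 1 / 3 ∧
      2 * (2 * (L : ℝ) ^ 2 * B₃ * σ) ≤ c2' 3 L ∧
      (N : ℝ) * (32 * ((3 : ℝ) + 1) * (3 + 4) * (L : ℝ) ^ 2 * (2 * (L : ℝ) ^ 2 * B₃ * σ)) < Real.pi := by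
  have hLr : (1 : ℝ) ≤ L := by exact_mod_cast hL
  have hNr : (1 : ℝ) ≤ N := by exact_mod_cast hN
  have hC0 := C0_pos 3
  have hA : 0 < 2 * (L : ℝ) ^ 2 * B₃ := by positivity
  have h1 : σ ≤ 1 / (3 * C0 3 * (2 * (L : ℝ) ^ 2 * B₃)) := hσ.trans (min_le_left _ _)
  have h2 : σ ≤ c2' 3 L / (2 * (2 * (L : ℝ) ^ 2 * B₃)) := hσ.trans ((min_le_right _ _).trans (min_le_left _ _))
  have h3 : σ ≤ Real.pi / (2 * ((N : ℝ) * (32 * ((3 : ℝ) + 1) * (3 + 4) * (L : ℝ) ^ 2 * (2 * (L : ℝ) ^ 2 * B₃)))) :=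
    hσ.trans ((min_le_right _ _).trans (min_le_right _ _))
  refine ⟨?_, ?_, ?_⟩
  · rw [le_div_iff₀ (by positivity)] at h1
    nlinarith
  · rw [le_div_iff₀ (by positivity)] at h2
    nlinarith
  · have hD : 0 < 2 * ((N : ℝ) * (32 * ((3 : ℝ) + 1) * (3 + 4) * (L : ℝ) ^ 2 * (2 * (L : ℝ) ^ 2 * B₃))) := by
      positivity
    rw [le_div_iff₀ hD] at h3
    nlinarith [Real.pi_pos]

/-- The threshold of (44)–(46): `sigmaReg` and (45)'s «8L²B₃Z₃·s ≤ ½». [cite: Balaban1985UV3, (45) p.267] -/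
def sigma46 (L N : ℕ) (B₃ M₁ κ₁ : ℝ) : ℝ :=
  min (sigmaReg L N B₃) (1 / (2 * (8 * (L : ℝ) ^ 2 * B₃ * Z3 M₁ κ₁)))

/-- `sigma46 > 0`. [folklore] -/
theorem sigma46_pos {L N : ℕ} {B₃ M₁ κ₁ : ℝ} (hL : 1 ≤ L) (hN : 1 ≤ N) (hB : 0 < B₃) (hM : 0 < M₁) (hκ : 0 < κ₁) :
    0 < sigma46 L N B₃ M₁ κ₁ := by
  have hLr : (1 : ℝ) ≤ L := by exact_mod_cast hL
  have hZ := Z3_pos hM hκ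
  unfold sigma46
  exact lt_min (sigmaReg_pos hL hN hB) (by positivity)

/-- EXPORT: for `σ ≤ sigma46`, the four premises `hσ₁`–`hσ₄` of the leaf form `bound46_leaf` (HOME drafts/p2/Bound46Knit.lean :104, a documentation draft, not in the tree; they feed `hα3`/`hα2`/`hαN`/`hsmall` of LQB `B10Eq44SpecialUnitary.bound46_specialUnitary`); the tree's (46)-leaves `Bound46Series.bound46_series_of_steps` / `Bound46Std.bound46_stdTowerInput` take `hγ46` via `gammaOf_spec` instead. [cite: Balaban1985UV3, (44)–(45) p.267] -/
theorem sigma46_spec {L N : ℕ} {B₃ M₁ κ₁ σ : ℝ} (hL : 1 ≤ L) (hN : 1 ≤ N) (hB : 0 < B₃) (hM : 0 < M₁) (hκ : 0 < κ₁)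
    (hσ : σ ≤ sigma46 L N B₃ M₁ κ₁) :
    C0 3 * (2 * (L : ℝ) ^ 2 * B₃ * σ) ≤ 1 / 3 ∧
      2 * (2 * (L : ℝ) ^ 2 * B₃ * σ) ≤ c2' 3 L ∧
      (N : ℝ) * (32 * ((3 : ℝ) + 1) * (3 + 4) * (L : ℝ) ^ 2 * (2 * (L : ℝ) ^ 2 * B₃ * σ)) < Real.pi ∧
      8 * (L : ℝ) ^ 2 * B₃ * (3 * ((2 * M₁ / κ₁) * (1 + 4 * M₁ / κ₁) ^ 3)) * σ ≤ 1 / 2 := by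
  have hLr : (1 : ℝ) ≤ L := by exact_mod_cast hL
  have hreg := sigmaReg_spec hL hN hB (hσ.trans (min_le_left _ _))
  have hZ := Z3_pos hM hκ
  have h4 : σ ≤ 1 / (2 * (8 * (L : ℝ) ^ 2 * B₃ * Z3 M₁ κ₁)) := hσ.trans (min_le_right _ _)
  refine ⟨hreg.1, hreg.2.1, hreg.2.2, ?_⟩
  rw [le_div_iff₀ (by positivity)] at h4
  show 8 * (L : ℝ) ^ 2 * B₃ * Z3 M₁ κ₁ * σ ≤ 1 / 2
  nlinarith

/-- The constant of (71)'s «for g_j sufficiently small»: `K₇₁ = ½(2C₁C₂ + C₂²)`, `C₁ = 2L²B₃`, `C₂ = (16/3)C₀C₁²`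
(`B10Eq71Concrete.smallFactor_specialUnitary`, hypothesis `hsmall`). [cite: Balaban1985UV3, (71) p.273] -/
def K71 (L : ℕ) (B₃ : ℝ) : ℝ :=
  (2 * (2 * (L : ℝ) ^ 2 * B₃) * (16 / 3 * C0 3 * (2 * (L : ℝ) ^ 2 * B₃) ^ 2) +
    (16 / 3 * C0 3 * (2 * (L : ℝ) ^ 2 * B₃) ^ 2) ^ 2) / 2

/-- `K₇₁ > 0`. [folklore] -/
theorem K71_pos {L : ℕ} {B₃ : ℝ} (hL : 1 ≤ L) (hB : 0 < B₃) : 0 < K71 L B₃ := by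
  have hLr : (1 : ℝ) ≤ L := by exact_mod_cast hL
  have hC0 := C0_pos 3
  unfold K71; positivity

/-- The threshold of (67)–(71): `sigmaReg`, `σ ≤ 1` (`g_jp(g_j) ≤ 1`) and `K₇₁σ ≤ ¼`. [cite: Balaban1985UV3, (71) p.273] -/
def sigma71 (L N : ℕ) (B₃ : ℝ) : ℝ := min (sigmaReg L N B₃) (min 1 (1 / (4 * K71 L B₃)))

/-- `sigma71 > 0`. [folklore] -/
theorem sigma71_pos {L N : ℕ} {B₃ : ℝ} (hL : 1 ≤ L) (hN : 1 ≤ N) (hB : 0 < B₃) : 0 < sigma71 L N B₃ := by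
  have hK := K71_pos hL hB
  unfold sigma71
  exact lt_min (sigmaReg_pos hL hN hB) (lt_min one_pos (by positivity))

/-- EXPORT: for `σ ≤ sigma71`, the premises `hσ1`, `hσ₁`, `hσ₂`, `hσ₃`, `hσ₅` of `PerPlaquette71.perPlaquette71_run`.
[cite: Balaban1985UV3, (68)–(71) p.273] -/
theorem sigma71_spec {L N : ℕ} {B₃ σ : ℝ} (hL : 1 ≤ L) (hN : 1 ≤ N) (hB : 0 < B₃)
    (hσ : σ ≤ sigma71 L N B₃) :
    σ ≤ 1 ∧ C0 3 * (2 * (L : ℝ) ^ 2 * B₃ * σ) ≤ 1 / 3 ∧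
      2 * (2 * (L : ℝ) ^ 2 * B₃ * σ) ≤ c2' 3 L ∧
      (N : ℝ) * (32 * ((3 : ℝ) + 1) * (3 + 4) * (L : ℝ) ^ 2 * (2 * (L : ℝ) ^ 2 * B₃ * σ)) < Real.pi ∧
      (2 * (2 * (L : ℝ) ^ 2 * B₃) * (16 / 3 * C0 3 * (2 * (L : ℝ) ^ 2 * B₃) ^ 2) +
        (16 / 3 * C0 3 * (2 * (L : ℝ) ^ 2 * B₃) ^ 2) ^ 2) / 2 * σ ≤ 1 / 4 := by
  have hreg := sigmaReg_spec hL hN hB (hσ.trans (min_le_left _ _))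
  have hK := K71_pos hL hB
  have h1 : σ ≤ 1 := hσ.trans ((min_le_right _ _).trans (min_le_left _ _))
  have h5 : σ ≤ 1 / (4 * K71 L B₃) := hσ.trans ((min_le_right _ _).trans (min_le_right _ _))
  refine ⟨h1, hreg.1, hreg.2.1, hreg.2.2, ?_⟩
  rw [le_div_iff₀ (by positivity)] at h5
  show K71 L B₃ * σ ≤ 1 / 4
  nlinarith

end Sigma

/-! ## §2 The `γ`-thresholds on the coupling -/

section Gamma

/-- `Q₀(p₀) = (2p₀)^{p₀}e^{½−p₀}`: `g·p(g) ≤ b₀Q₀√g` (`CouplingWindow.gp_le_sqrt`). [folklore] -/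
def Q0 (p₀ : ℝ) : ℝ := (2 * p₀) ^ p₀ * Real.exp (1 / 2 - p₀)

/-- `Q₀ > 0` for `p₀ > 0`. [folklore] -/
theorem Q0_pos {p₀ : ℝ} (hp : 0 < p₀) : 0 < Q0 p₀ := by unfold Q0; positivity

/-- The coupling threshold for «g·p(g) ≤ σ»: `γ(σ) = min 1 (σ/(b₀Q₀))²`. [cite: Balaban1985UV3, p.256 + p.267 + p.273] -/
def gammaOf (b₀ p₀ σ : ℝ) : ℝ := min 1 ((σ / (b₀ * Q0 p₀)) ^ 2)

/-- `γ(σ) > 0` for `b₀, p₀, σ > 0`; `γ(σ) ≤ 1`. [folklore] -/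
theorem gammaOf_pos_le {b₀ p₀ σ : ℝ} (hb : 0 < b₀) (hp : 0 < p₀) (hσ : 0 < σ) :
    0 < gammaOf b₀ p₀ σ ∧ gammaOf b₀ p₀ σ ≤ 1 := by
  have hQ := Q0_pos hp
  have hq : 0 < σ / (b₀ * Q0 p₀) := by positivity
  unfold gammaOf
  exact ⟨lt_min one_pos (by positivity), min_le_left _ _⟩

/-- EXPORT: `0 < g ≤ γ(σ) ⇒ g·p(g) ≤ σ` (`CouplingWindow.gp_le_of_le_gamma`). [cite: Balaban1985UV3, p.256 + p.267 + p.273] -/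
theorem gammaOf_spec {b₀ p₀ σ g : ℝ} (hb : 0 < b₀) (hp : 0 < p₀) (hσ : 0 ≤ σ) (hg : 0 < g) (hgγ : g ≤ gammaOf b₀ p₀ σ) :
    g * B10.pFun b₀ p₀ g ≤ σ :=
  gp_le_of_le_gamma b₀ p₀ σ (gammaOf b₀ p₀ σ) g hb hp hσ (min_le_right _ _) (min_le_left _ _) hg hgγ

/-- The radius threshold `τ₄₆ = 1/(8L²B₃b₀(R₁M₁·(r₀/4)^{r₀}e^{4−r₀}·Q₀(p₀+r₀) + Q₀(p₀)))` of `CouplingWindow.hD_of_threshold`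
(`4L²B₃b₀(…)·τ₄₆ = ½`). [cite: Balaban1985UV3, (43) p.266, (44) p.267] -/
def tau46 (L : ℕ) (B₃ b₀ p₀ r₀ R₁M₁ : ℝ) : ℝ :=
  1 / (2 * (4 * (L : ℝ) ^ 2 * B₃ * (b₀ * (R₁M₁ * ((r₀ / 4) ^ r₀ * Real.exp (4 - r₀)) * Q0 (p₀ + r₀) + Q0 p₀))))

/-- `τ₄₆ > 0` and `4L²B₃b₀(…)·τ₄₆ ≤ ½`. [folklore] -/
theorem tau46_spec {L : ℕ} {B₃ b₀ p₀ r₀ R₁M₁ : ℝ} (hL : 1 ≤ L) (hB : 0 < B₃) (hb : 0 < b₀) (hp : 0 < p₀) (hr : 0 ≤ r₀)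
    (hRM : 0 ≤ R₁M₁) :
    0 < tau46 L B₃ b₀ p₀ r₀ R₁M₁ ∧
      4 * (L : ℝ) ^ 2 * B₃ * (b₀ * (R₁M₁ * ((r₀ / 4) ^ r₀ * Real.exp (4 - r₀)) *
        ((2 * (p₀ + r₀)) ^ (p₀ + r₀) * Real.exp (1 / 2 - (p₀ + r₀))) + (2 * p₀) ^ p₀ * Real.exp (1 / 2 - p₀))) *
        tau46 L B₃ b₀ p₀ r₀ R₁M₁ ≤ 1 / 2 := by
  have hLr : (1 : ℝ) ≤ L := by exact_mod_cast hL
  have hQ0 := Q0_pos hp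
  have hQ1 : 0 < Q0 (p₀ + r₀) := Q0_pos (by linarith)
  have hK : 0 ≤ R₁M₁ * ((r₀ / 4) ^ r₀ * Real.exp (4 - r₀)) * Q0 (p₀ + r₀) := by positivity
  have hD : 0 < 4 * (L : ℝ) ^ 2 * B₃ * (b₀ * (R₁M₁ * ((r₀ / 4) ^ r₀ * Real.exp (4 - r₀)) * Q0 (p₀ + r₀) + Q0 p₀)) := by
    positivity
  refine ⟨by unfold tau46; positivity, ?_⟩
  show 4 * (L : ℝ) ^ 2 * B₃ * (b₀ * (R₁M₁ * ((r₀ / 4) ^ r₀ * Real.exp (4 - r₀)) * Q0 (p₀ + r₀) + Q0 p₀)) *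
      tau46 L B₃ b₀ p₀ r₀ R₁M₁ ≤ 1 / 2
  unfold tau46
  rw [← mul_div_assoc, mul_one, div_le_iff₀ (by positivity)]
  linarith

/-- **`γ₄₆`**, the coupling threshold of row B15 (46): `min (γ(sigma46)) τ₄₆²`. [cite: Balaban1985UV3, (43)–(46) pp.266–267] -/
def gamma46 (L N : ℕ) (B₃ M₁ κ₁ b₀ p₀ r₀ R₁M₁ : ℝ) : ℝ :=
  min (gammaOf b₀ p₀ (sigma46 L N B₃ M₁ κ₁)) (tau46 L B₃ b₀ p₀ r₀ R₁M₁ ^ 2)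

/-- `0 < γ₄₆ ≤ 1`. [folklore] -/
theorem gamma46_pos_le {L N : ℕ} {B₃ M₁ κ₁ b₀ p₀ r₀ R₁M₁ : ℝ} (hL : 1 ≤ L) (hN : 1 ≤ N) (hB : 0 < B₃) (hM : 0 < M₁)
    (hκ : 0 < κ₁) (hb : 0 < b₀) (hp : 0 < p₀) (hr : 0 ≤ r₀) (hRM : 0 ≤ R₁M₁) :
    0 < gamma46 L N B₃ M₁ κ₁ b₀ p₀ r₀ R₁M₁ ∧ gamma46 L N B₃ M₁ κ₁ b₀ p₀ r₀ R₁M₁ ≤ 1 := by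
  have h1 := gammaOf_pos_le hb hp (sigma46_pos hL hN hB hM hκ)
  have h2 := (tau46_spec hL hB hb hp hr hRM).1
  unfold gamma46
  exact ⟨lt_min h1.1 (by positivity), (min_le_left _ _).trans h1.2⟩

/-- EXPORT (R-EPS0′): `0 < g ≤ γ₄₆ ⇒ g·p(g) ≤ sigma46 ∧ √g ≤ τ₄₆` — the two coupling premises (`hs`, `hτ`) of
the leaf form `bound46_leaf` (HOME drafts/p2/Bound46Knit.lean :104, a documentation draft, not in the tree) / `CouplingWindow.hD_of_threshold` at `g = g_{k−1}` (the tree's (46)-leaves `Bound46Series.bound46_series_of_steps` / `Bound46Std.bound46_stdTowerInput` take `hγ46` via `gammaOf_spec`). [cite: Balaban1985UV3, (44)–(46) p.267] -/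
theorem gamma46_spec {L N : ℕ} {B₃ M₁ κ₁ b₀ p₀ r₀ R₁M₁ g : ℝ} (hL : 1 ≤ L) (hN : 1 ≤ N) (hB : 0 < B₃) (hM : 0 < M₁)
    (hκ : 0 < κ₁) (hb : 0 < b₀) (hp : 0 < p₀) (hr : 0 ≤ r₀) (hRM : 0 ≤ R₁M₁) (hg : 0 < g)
    (hgγ : g ≤ gamma46 L N B₃ M₁ κ₁ b₀ p₀ r₀ R₁M₁) :
    g * B10.pFun b₀ p₀ g ≤ sigma46 L N B₃ M₁ κ₁ ∧ Real.sqrt g ≤ tau46 L B₃ b₀ p₀ r₀ R₁M₁ := by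
  have hσ := sigma46_pos hL hN hB hM hκ
  have hτ := (tau46_spec hL hB hb hp hr hRM).1
  refine ⟨gammaOf_spec hb hp hσ.le hg (hgγ.trans (min_le_left _ _)), ?_⟩
  calc Real.sqrt g ≤ Real.sqrt (tau46 L B₃ b₀ p₀ r₀ R₁M₁ ^ 2) := Real.sqrt_le_sqrt (hgγ.trans (min_le_right _ _))
    _ = tau46 L B₃ b₀ p₀ r₀ R₁M₁ := Real.sqrt_sq hτ.le

/-- **`γ₇₁`**, the coupling threshold of row B25's small factors (71): `γ(sigma71)`. [cite: Balaban1985UV3, (67)–(71) p.273] -/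
def gamma71 (L N : ℕ) (B₃ b₀ p₀ : ℝ) : ℝ := gammaOf b₀ p₀ (sigma71 L N B₃)

/-- `0 < γ₇₁ ≤ 1`. [folklore] -/
theorem gamma71_pos_le {L N : ℕ} {B₃ b₀ p₀ : ℝ} (hL : 1 ≤ L) (hN : 1 ≤ N) (hB : 0 < B₃) (hb : 0 < b₀) (hp : 0 < p₀) :
    0 < gamma71 L N B₃ b₀ p₀ ∧ gamma71 L N B₃ b₀ p₀ ≤ 1 :=
  gammaOf_pos_le hb hp (sigma71_pos hL hN hB)

/-- EXPORT (R-EPS0′): `0 < g ≤ γ₇₁ ⇒ g·p(g) ≤ sigma71` — the coupling premises `hs_j`, `hs_k` of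
`PerPlaquette71.perPlaquette71_run`. [cite: Balaban1985UV3, (71) p.273] -/
theorem gamma71_spec {L N : ℕ} {B₃ b₀ p₀ g : ℝ} (hL : 1 ≤ L) (hN : 1 ≤ N) (hB : 0 < B₃) (hb : 0 < b₀) (hp : 0 < p₀)
    (hg : 0 < g) (hgγ : g ≤ gamma71 L N B₃ b₀ p₀) : g * B10.pFun b₀ p₀ g ≤ sigma71 L N B₃ :=
  gammaOf_spec hb hp (sigma71_pos hL hN hB).le hg hgγ

end Gamma

/-! ## §3 The thresholds of the LOCAL small factor (68)–(71) (`B10Eq69Local`, `O(1) = C₁` of (68) explicit) -/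

section Local71

/-- The constant of (71)'s «for g_j sufficiently small» in the LOCAL form of the 4D cell (`B10Eq69Local.smallFactor_of_largeField_concrete`,
hypothesis `hsmall`): `K₇₁ᴸ(C₁) = ½(2C₁C₂ + C₂²)`, `C₂ = 6C₀C₁²`, `C₁` = the `O(1)` of **(68)** p. 273 «|U_k(∂p) − 1| <
O(1)g_jp(g_j)L^{−2j}» on `B^j(Λ_j)`. [cite: Balaban1985UV3, (68)–(71) p.273] -/
def K71L (C₁ : ℝ) : ℝ := (2 * C₁ * (6 * C0 3 * C₁ ^ 2) + (6 * C0 3 * C₁ ^ 2) ^ 2) / 2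

/-- `K₇₁ᴸ > 0` for `C₁ > 0`. [folklore] -/
theorem K71L_pos {C₁ : ℝ} (hC : 0 < C₁) : 0 < K71L C₁ := by
  have hC0 := C0_pos 3
  unfold K71L; positivity

/-- The threshold on `s = g_jp(g_j)` for the local small factor: [4] Prop. 2 smallness for `α₀ = C₁s` (`C₀α₀ ≤ ⅓`, `2α₀ ≤ c₂′(3, L)`),
`s ≤ 1`, and `K₇₁ᴸ·s ≤ ¼`. [cite: Balaban1985UV3, (68)–(71) p.273] -/
def sigma68 (C₁ : ℝ) (L : ℕ) : ℝ :=
  min (1 / (3 * C0 3 * C₁)) (min (c2' 3 L / (2 * C₁)) (min 1 (1 / (4 * K71L C₁))))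

/-- `sigma68 > 0` (`C₁ > 0`, `L ≥ 1`). [folklore] -/
theorem sigma68_pos {C₁ : ℝ} {L : ℕ} (hC : 0 < C₁) (hL : 1 ≤ L) : 0 < sigma68 C₁ L := by
  have hC0 := C0_pos 3
  have hc2 := c2'_pos 3 L hL
  have hK := K71L_pos hC
  unfold sigma68
  exact lt_min (by positivity) (lt_min (by positivity) (lt_min one_pos (by positivity)))

/-- EXPORT: for `σ ≤ sigma68 C₁ L`, the four premises `hα3`, `hα2`, `hgp`, `hsmall` of `B10Eq69Local.smallFactor_of_largeField_concrete`
at `α₀ = C₁σ`. [cite: Balaban1985UV3, (68)–(71) p.273] -/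
theorem sigma68_spec {C₁ σ : ℝ} {L : ℕ} (hC : 0 < C₁) (hσ : σ ≤ sigma68 C₁ L) :
    C0 3 * (C₁ * σ) ≤ 1 / 3 ∧ 2 * (C₁ * σ) ≤ c2' 3 L ∧ σ ≤ 1 ∧ K71L C₁ * σ ≤ 1 / 4 := by
  have hC0 := C0_pos 3
  have hK := K71L_pos hC
  have h1 : σ ≤ 1 / (3 * C0 3 * C₁) := hσ.trans (min_le_left _ _)
  have h2 : σ ≤ c2' 3 L / (2 * C₁) := hσ.trans ((min_le_right _ _).trans (min_le_left _ _))
  have h3 : σ ≤ 1 := hσ.trans ((min_le_right _ _).trans ((min_le_right _ _).trans (min_le_left _ _)))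
  have h4 : σ ≤ 1 / (4 * K71L C₁) := hσ.trans ((min_le_right _ _).trans ((min_le_right _ _).trans (min_le_right _ _)))
  refine ⟨?_, ?_, h3, ?_⟩
  · rw [le_div_iff₀ (by positivity)] at h1
    nlinarith
  · rw [le_div_iff₀ (by positivity)] at h2
    nlinarith
  · rw [le_div_iff₀ (by positivity)] at h4
    nlinarith

/-- **`γ₇₁ᴸ`**, the coupling threshold of the LOCAL small factor: `γ(sigma68 C₁ L)`. [cite: Balaban1985UV3, (68)–(71) p.273] -/
def gamma71L (C₁ : ℝ) (L : ℕ) (b₀ p₀ : ℝ) : ℝ := gammaOf b₀ p₀ (sigma68 C₁ L)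

/-- `0 < γ₇₁ᴸ ≤ 1`. [folklore] -/
theorem gamma71L_pos_le {C₁ b₀ p₀ : ℝ} {L : ℕ} (hC : 0 < C₁) (hL : 1 ≤ L) (hb : 0 < b₀) (hp : 0 < p₀) :
    0 < gamma71L C₁ L b₀ p₀ ∧ gamma71L C₁ L b₀ p₀ ≤ 1 :=
  gammaOf_pos_le hb hp (sigma68_pos hC hL)

/-- EXPORT (R-EPS0′): `0 < g ≤ γ₇₁ᴸ ⇒ g·p(g) ≤ sigma68 C₁ L`. [cite: Balaban1985UV3, (71) p.273] -/
theorem gamma71L_spec {C₁ b₀ p₀ g : ℝ} {L : ℕ} (hC : 0 < C₁) (hL : 1 ≤ L) (hb : 0 < b₀) (hp : 0 < p₀) (hg : 0 < g)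
    (hgγ : g ≤ gamma71L C₁ L b₀ p₀) : g * B10.pFun b₀ p₀ g ≤ sigma68 C₁ L :=
  gammaOf_spec hb hp (sigma68_pos hC hL).le hg hgγ

end Local71

end Summit.QuantumFields.Balaban3D.Proofs.Thresholds

end
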